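import Summits.BirchSwinnertonDyer.BirchSwinnertonDyer.Theorems.EisensteinPrimesBSDpOnCellCTelescopeBranchTwistExpSeries
import Summits.BirchSwinnertonDyer.Rank1Residual.X11b.HalvesReceptacle
import Mathlib.NumberTheory.Padics.ProperSpace
import HarnessLib

/-!
# [telescope — LEAD cruxlead-19034 g7, 2026-08-30] Brick G0 of «(F) CONSTRUCTED IN TREE»: COEFFICIENT DESCENT
`R₀⟦X⟧ → ℤ_p⟦X⟧` along the chart — a series with `ℤ_p`-rational Weierstrass remainders at a null sequence of
non-zero `ℤ_p`-points has `ℤ_p`-coefficients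

Crux 4 `BSDpOnCellC` (stmt-BirchSwinnertonDyer-19034), line «telescope» v19. The analytic chart of T-An-2
(`IsPNewBranchAnalyticChart`) hands the Hecke-eigenvalue interpolants `A_ℓ ∈ R₀⟦X⟧` (`R₀ = unrIntegers p ⊂ ℂ_p`, structure
map `j : ℤ_p → R₀`) in WEIERSTRASS-REMAINDER form `A_ℓ = C c_t + (X − C (j x_t))·U_t` at the member points `x_t ∈ ℤ_p`
(`x_t → 0`, `x_t ≠ 0`), and (F-rat) makes the remainder constants `c_t = ı_p a_ℓ(g_t)` lie in `j(ℤ_p)`. Brick G1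
(`…TelescopeBranchTraceInterpolation`) glues `ℤ_p⟦X⟧`-valued data; this file supplies the descent that feeds it:

* §1 the `j`-arithmetic for the structure map `j : ℤ_p → R₀` (`R₀` lies in the closed unit ball — reused BY NAME from
  `Summit.BirchSwinnertonDyer.Rank1Residual.X11b.Halves.norm_coe_unrIntegers_le_one`): `j` is isometric onto its image and injective (`eq_of_j_eq`), `range j` is closed, `constantCoeff_eq_of_map_eq` reads the `X = 0` fibre, and
  `j x · u = j z`, `x ≠ 0`, `u ∈ R₀` force `u ∈ range j` (`mem_range_of_mul_eq`);
* §2 one descent step (`remainder_shift`): from `F = C c + (X − C a)·U` one gets `constantCoeff F = c − a·U(0)` and the SAME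
  shape for the shifted series, `shift F = C (U 0) + (X − C a)·shift U`;
* §3 the descent (`exists_map_eq_of_remainders`): if every `t` admits `c_t ∈ range j` and `U_t` with
  `F = C c_t + (X − C (j x_t))·U_t`, then `F = PowerSeries.map j F₀` for a (unique) `F₀ ∈ ℤ_p⟦X⟧`;
* §4 the values (`coe_j_evalHom_eq_of_remainder`): for such `F₀`, `j (evalHom (x t) F₀) = c_t` — the remainder constant IS the
  value (uniqueness of the Weierstrass remainder constant in `R₀⟦X⟧`, `remainder_const_unique`, from `‖j x_t‖ < 1`).

Pure `p`-adic algebra; no Galois theory, no modular forms. Helper toward crux 4 (`--supports`); closes NO registered stub,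
changes no registered token, proves no cited fact and no summit statement; BSD is proved for no curve.
-/

set_option autoImplicit false
set_option linter.dupNamespace false

open scoped Topology
open Filter PowerSeries
open Literature.NumberTheory.EllipticCurves

namespace Summit.BirchSwinnertonDyer.BirchSwinnertonDyer.Theorems.TelescopeBranchCoefficientDescent

variable {p : ℕ} [Fact p.Prime]

/-! ### §1. `R₀ ⊂ 𝒪_{ℂ_p}` and the structure map `j : ℤ_p → R₀` -/

section StructureMap

variable (j : ℤ_[p] →+* unrIntegers p)
  (hj : ∀ z : ℤ_[p], ((j z : unrIntegers p) : ℂ_[p]) = algebraMap ℚ_[p] ℂ_[p] (z : ℚ_[p]))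

include hj

/-- The structure map `j : ℤ_p → R₀` (characterised by its values in `ℂ_p`) is an isometry onto its image:
`‖j z‖ = ‖z‖`. [folklore] -/
theorem norm_coe_j (z : ℤ_[p]) : ‖((j z : unrIntegers p) : ℂ_[p])‖ = ‖z‖ := by
  rw [hj, norm_algebraMap', PadicInt.padic_norm_e_of_padicInt]

/-- `j` is injective, stated pointwise: `j z = j z' → z = z'` (read in `ℂ_p`, where `ℚ_p → ℂ_p` is injective). [folklore] -/
theorem eq_of_j_eq {z z' : ℤ_[p]} (h : j z = j z') : z = z' := by
  have h' : ((j z : unrIntegers p) : ℂ_[p]) = ((j z' : unrIntegers p) : ℂ_[p]) := by rw [h]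
  rw [hj, hj] at h'
  exact Subtype.ext ((algebraMap ℚ_[p] ℂ_[p]).injective h')

/-- Reading the `X = 0` fibre through `j`: if `PowerSeries.map j F₀ = C (j a) + X·U` then `constantCoeff F₀ = a` (the chart's clause
«`A_ℓ = C (j a_ℓ(E)) + X·U`» descended). [folklore] -/
theorem constantCoeff_eq_of_map_eq (F₀ : ℤ_[p]⟦X⟧) {a : ℤ_[p]} {U : UnrSeries p}
    (h : PowerSeries.map j F₀ = C (j a) + X * U) : constantCoeff F₀ = a := by
  have h0 := congrArg constantCoeff h
  simp only [map_add, map_mul, constantCoeff_C, constantCoeff_X, zero_mul, add_zero] at h0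
  rw [← coeff_zero_eq_constantCoeff_apply, coeff_map, coeff_zero_eq_constantCoeff_apply] at h0
  exact eq_of_j_eq j hj h0

/-- `j`, read in `ℂ_p`, is continuous. [folklore] -/
theorem continuous_coe_j : Continuous fun z : ℤ_[p] => ((j z : unrIntegers p) : ℂ_[p]) := by
  have e : (fun z : ℤ_[p] => ((j z : unrIntegers p) : ℂ_[p])) =
      fun z : ℤ_[p] => algebraMap ℚ_[p] ℂ_[p] ((z : ℤ_[p]) : ℚ_[p]) :=
    funext fun z => hj z
  rw [e]
  exact (continuous_algebraMap ℚ_[p] ℂ_[p]).comp continuous_subtype_val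

/-- The image of `j`, read in `ℂ_p`, is closed (a continuous image of the compact `ℤ_p`). [folklore] -/
theorem isClosed_range_coe_j : IsClosed (Set.range fun z : ℤ_[p] => ((j z : unrIntegers p) : ℂ_[p])) :=
  (isCompact_range (continuous_coe_j j hj)).isClosed

/-- **Descent of a quotient**: if `j x · u = j z` in `R₀` with `x ≠ 0`, then `u ∈ range j` (indeed `u = j (z / x)`:
`‖u‖ ≤ 1` forces `‖z‖ ≤ ‖x‖`, i.e. `x ∣ z` in `ℤ_p`). [folklore] -/
theorem mem_range_of_mul_eq {x z : ℤ_[p]} (hx : x ≠ 0) {u : unrIntegers p} (h : j x * u = j z) :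
    u ∈ Set.range j := by
  -- in `ℚ_p`: `z / x` has norm `≤ 1`
  have hxQ : (x : ℚ_[p]) ≠ 0 := fun h => hx (PadicInt.coe_eq_zero.mp h)
  have hu1 : ‖(u : ℂ_[p])‖ ≤ 1 := Summit.BirchSwinnertonDyer.Rank1Residual.X11b.Halves.norm_coe_unrIntegers_le_one p u
  have hC : algebraMap ℚ_[p] ℂ_[p] (x : ℚ_[p]) * (u : ℂ_[p]) = algebraMap ℚ_[p] ℂ_[p] (z : ℚ_[p]) := by
    have := congrArg (fun w : unrIntegers p => (w : ℂ_[p])) h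
    simpa [hj] using this
  have huq : (u : ℂ_[p]) = algebraMap ℚ_[p] ℂ_[p] ((z : ℚ_[p]) / (x : ℚ_[p])) := by
    have hxC : algebraMap ℚ_[p] ℂ_[p] (x : ℚ_[p]) ≠ 0 := by
      rw [Ne, map_eq_zero_iff _ (algebraMap ℚ_[p] ℂ_[p]).injective]; exact hxQ
    rw [map_div₀, eq_div_iff hxC, mul_comm, hC]
  have hnorm : ‖(z : ℚ_[p]) / (x : ℚ_[p])‖ ≤ 1 := by
    have := hu1
    rwa [huq, norm_algebraMap'] at this
  -- so `z / x ∈ ℤ_p`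
  refine ⟨⟨(z : ℚ_[p]) / (x : ℚ_[p]), hnorm⟩, ?_⟩
  apply Subtype.ext
  rw [hj, huq]

end StructureMap

/-! ### §2. One descent step: the Weierstrass-remainder shape passes to the shifted series -/

/-- The shifted series `shift F = Σ a_{n+1} Xⁿ`, so that `F = X · shift F + C (F 0)`. [folklore] -/
theorem eq_X_mul_shift_add_C {R : Type*} [CommRing R] (F : R⟦X⟧) :
    F = X * PowerSeries.mk (fun n => coeff (n + 1) F) + C (constantCoeff F) :=
  PowerSeries.eq_X_mul_shift_add_const F

/-- From `F = C c + (X − C a)·U`: the constant coefficient is `c − a·U(0)`. [folklore] -/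
theorem constantCoeff_of_remainder {R : Type*} [CommRing R] {F U : R⟦X⟧} {c a : R}
    (h : F = C c + (X - C a) * U) : constantCoeff F = c - a * constantCoeff U := by
  have := congrArg constantCoeff h
  simp only [map_add, map_mul, map_sub, constantCoeff_C, constantCoeff_X, zero_sub, neg_mul] at this
  rw [this]; ring

/-- From `F = C c + (X − C a)·U`: the shifted series has the same shape, `shift F = C (U 0) + (X − C a)·shift U`.
[folklore] -/
theorem remainder_shift {R : Type*} [CommRing R] {F U : R⟦X⟧} {c a : R} (h : F = C c + (X - C a) * U) :
    PowerSeries.mk (fun n => coeff (n + 1) F) =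
      C (constantCoeff U) + (X - C a) * PowerSeries.mk (fun n => coeff (n + 1) U) := by
  ext n
  rw [coeff_mk, h, map_add, coeff_C, if_neg (Nat.succ_ne_zero n), zero_add, sub_mul, map_sub, coeff_succ_X_mul,
    coeff_C_mul, map_add, sub_mul, map_sub, coeff_C_mul, coeff_mk]
  rcases n with _ | n
  · rw [coeff_zero_C, coeff_zero_X_mul, coeff_zero_eq_constantCoeff_apply]; ring
  · rw [coeff_C, if_neg (Nat.succ_ne_zero n), coeff_succ_X_mul, coeff_mk]; ring

/-! ### §3. The descent -/

section Descent

variable (j : ℤ_[p] →+* unrIntegers p)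
  (hj : ∀ z : ℤ_[p], ((j z : unrIntegers p) : ℂ_[p]) = algebraMap ℚ_[p] ℂ_[p] (z : ℚ_[p]))
  (x : ℕ → ℤ_[p]) (hx0 : Tendsto x atTop (𝓝 0)) (hxne : ∀ t, x t ≠ 0)

include hj hx0 hxne

/-- **One step.** If `F ∈ R₀⟦X⟧` has, at every `t`, a Weierstrass remainder at `j x_t` with constant in `range j`, then
`constantCoeff F ∈ range j` and the shifted series has the same property. (`‖c_t − F(0)‖ = ‖x_t‖·‖U_t(0)‖ ≤ ‖x_t‖ → 0` and
`range j` is closed; then `j x_t · U_t(0) = c_t − F(0) ∈ range j` descends `U_t(0)` by `mem_range_of_mul_eq`.) [folklore] -/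
theorem descent_step (F : UnrSeries p)
    (hF : ∀ t, ∃ c U, c ∈ Set.range j ∧ F = C c + (X - C (j (x t))) * U) :
    constantCoeff F ∈ Set.range j ∧
      ∀ t, ∃ c U, c ∈ Set.range j ∧
        PowerSeries.mk (fun n => coeff (n + 1) F) = C c + (X - C (j (x t))) * U := by
  choose c U hc hFU using hF
  -- (B) `c_t → F(0)` in `ℂ_p`, hence `F(0) ∈ range j` (closed)
  have hlim : Tendsto (fun t => ((c t : unrIntegers p) : ℂ_[p])) atTop (𝓝 ((constantCoeff F : unrIntegers p) : ℂ_[p])) := by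
    rw [tendsto_iff_norm_sub_tendsto_zero]
    have hxn : Tendsto (fun t => ‖x t‖) atTop (𝓝 0) := by
      simpa using (tendsto_iff_norm_sub_tendsto_zero.mp hx0)
    refine squeeze_zero (fun t => norm_nonneg _) (fun t => ?_) hxn
    have e : constantCoeff F = c t - j (x t) * constantCoeff (U t) := constantCoeff_of_remainder (hFU t)
    have e' : ((c t : unrIntegers p) : ℂ_[p]) - ((constantCoeff F : unrIntegers p) : ℂ_[p]) =
        ((j (x t) : unrIntegers p) : ℂ_[p]) * ((constantCoeff (U t) : unrIntegers p) : ℂ_[p]) := by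
      rw [e]; push_cast; ring
    rw [e', norm_mul, norm_coe_j j hj]
    exact mul_le_of_le_one_right (norm_nonneg _) (Summit.BirchSwinnertonDyer.Rank1Residual.X11b.Halves.norm_coe_unrIntegers_le_one p _)
  have hmem : ((constantCoeff F : unrIntegers p) : ℂ_[p]) ∈ Set.range fun z : ℤ_[p] => ((j z : unrIntegers p) : ℂ_[p]) := by
    refine (isClosed_range_coe_j j hj).mem_of_tendsto hlim (Eventually.of_forall fun t => ?_)
    obtain ⟨z, hz⟩ := hc t
    exact ⟨z, congrArg (fun w : unrIntegers p => (w : ℂ_[p])) hz⟩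
  have hF0 : constantCoeff F ∈ Set.range j := by
    obtain ⟨z, hz⟩ := hmem
    exact ⟨z, Subtype.ext hz⟩
  refine ⟨hF0, fun t => ⟨constantCoeff (U t), PowerSeries.mk (fun n => coeff (n + 1) (U t)), ?_, remainder_shift (hFU t)⟩⟩
  -- (C) `j x_t · U_t(0) = c_t − F(0) ∈ range j` descends `U_t(0)`
  obtain ⟨z₁, hz₁⟩ := hc t
  obtain ⟨z₀, hz₀⟩ := hF0
  have e : j (x t) * constantCoeff (U t) = j (z₁ - z₀) := by
    rw [map_sub, hz₁, hz₀, constantCoeff_of_remainder (hFU t)]; ring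
  exact mem_range_of_mul_eq j hj (hxne t) e

/-- **Coefficient descent.** If `F ∈ R₀⟦X⟧` has, at every member point, a Weierstrass remainder at `j x_t` whose constant is
`ℤ_p`-rational (`∈ range j`), along a null sequence `x_t ≠ 0`, then EVERY coefficient of `F` is in `range j`, i.e.
`F = PowerSeries.map j F₀` for some `F₀ ∈ ℤ_p⟦X⟧`. [folklore] -/
theorem exists_map_eq_of_remainders (F : UnrSeries p)
    (hF : ∀ t, ∃ c U, c ∈ Set.range j ∧ F = C c + (X - C (j (x t))) * U) :
    ∃ F₀ : ℤ_[p]⟦X⟧, F = PowerSeries.map j F₀ := by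
  -- every coefficient is in the range, by induction on the index uniformly in `F`
  have key : ∀ n : ℕ, ∀ G : UnrSeries p,
      (∀ t, ∃ c U, c ∈ Set.range j ∧ G = C c + (X - C (j (x t))) * U) → coeff n G ∈ Set.range j := by
    intro n
    induction n with
    | zero =>
      intro G hG
      rw [coeff_zero_eq_constantCoeff_apply]
      exact (descent_step j hj x hx0 hxne G hG).1
    | succ n ih =>
      intro G hG
      have h := ih (PowerSeries.mk fun m => coeff (m + 1) G) (descent_step j hj x hx0 hxne G hG).2
      rwa [coeff_mk] at h
  choose a ha using fun n => key n F hF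
  refine ⟨PowerSeries.mk a, ?_⟩
  ext n
  rw [coeff_map, coeff_mk, ha n]

end Descent

/-! ### §4. The remainder constant is the value -/

/-- **Uniqueness of the Weierstrass remainder constant in `R₀⟦X⟧`** at a point `a` with `‖a‖ < 1`: if
`C c + (X − C a)·U = C c' + (X − C a)·U'` then `c = c'`. (With `G = U − U'`: `c' − c = −a·G₀` and `G_n = a·G_{n+1}`, so
`‖G₀‖ ≤ ‖a‖ⁿ → 0`.) [folklore] -/
theorem remainder_const_unique {a : unrIntegers p} (ha : ‖(a : ℂ_[p])‖ < 1) {c c' : unrIntegers p}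
    {U U' : UnrSeries p} (h : C c + (X - C a) * U = C c' + (X - C a) * U') : c = c' := by
  set G : UnrSeries p := U - U' with hG
  have hrel : C (c - c') = -((X - C a) * G) := by
    have : C c + (X - C a) * U - (C c' + (X - C a) * U') = 0 := by rw [h, sub_self]
    rw [map_sub, hG, mul_sub]
    linear_combination this
  -- coefficients: `c − c' = a·G₀` and `G_n = a·G_{n+1}`
  have h0 : c - c' = a * constantCoeff G := by
    have := congrArg constantCoeff hrel
    simp only [constantCoeff_C, map_neg, map_mul, map_sub, constantCoeff_X, zero_sub, neg_mul, neg_neg] at this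
    exact this
  have hsucc : ∀ n : ℕ, coeff n G = a * coeff (n + 1) G := by
    intro n
    have := congrArg (coeff (n + 1)) hrel
    rw [coeff_C, if_neg (Nat.succ_ne_zero n), map_neg, sub_mul, map_sub, coeff_succ_X_mul, coeff_C_mul] at this
    -- `0 = -(G n - a * G (n+1))`
    have e : coeff n G - a * coeff (n + 1) G = 0 := by
      have := this.symm
      rwa [neg_eq_zero] at this
    exact sub_eq_zero.mp e
  have hpow : ∀ n : ℕ, constantCoeff G = a ^ n * coeff n G := by
    intro n
    induction n with
    | zero => rw [pow_zero, one_mul, coeff_zero_eq_constantCoeff_apply]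
    | succ n ih => rw [ih, hsucc n, pow_succ]; ring
  -- norms: `‖G₀‖ ≤ ‖a‖ⁿ`, which tends to `0`
  have hG0 : constantCoeff G = 0 := by
    have hle : ∀ n : ℕ, ‖((constantCoeff G : unrIntegers p) : ℂ_[p])‖ ≤ ‖(a : ℂ_[p])‖ ^ n := by
      intro n
      rw [hpow n]
      push_cast
      rw [norm_mul, norm_pow]
      exact mul_le_of_le_one_right (pow_nonneg (norm_nonneg _) n) (Summit.BirchSwinnertonDyer.Rank1Residual.X11b.Halves.norm_coe_unrIntegers_le_one p _)
    have hlim : Tendsto (fun n : ℕ => ‖(a : ℂ_[p])‖ ^ n) atTop (𝓝 0) :=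
      tendsto_pow_atTop_nhds_zero_of_lt_one (norm_nonneg _) ha
    have h0' : ‖((constantCoeff G : unrIntegers p) : ℂ_[p])‖ = 0 :=
      le_antisymm (ge_of_tendsto' hlim hle) (norm_nonneg _)
    have : ((constantCoeff G : unrIntegers p) : ℂ_[p]) = 0 := norm_eq_zero.mp h0'
    exact_mod_cast this
  have : c - c' = 0 := by rw [h0, hG0, mul_zero]
  exact sub_eq_zero.mp this

/-- **The remainder constant is the value.** If `F = PowerSeries.map j F₀` and `F = C c + (X − C (j x_t))·U` in `R₀⟦X⟧`
with `‖x_t‖ < 1`, then `j (F₀(x_t)) = c` (`F₀(x_t) = evalHom (x t) F₀`). [folklore] -/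
theorem coe_j_evalHom_eq_of_remainder (j : ℤ_[p] →+* unrIntegers p)
    (hj : ∀ z : ℤ_[p], ((j z : unrIntegers p) : ℂ_[p]) = algebraMap ℚ_[p] ℂ_[p] (z : ℚ_[p]))
    (F₀ : ℤ_[p]⟦X⟧) {t : ℤ_[p]} (ht : ‖t‖ < 1) {c : unrIntegers p} {U : UnrSeries p}
    (h : PowerSeries.map j F₀ = C c + (X - C (j t)) * U) : j (evalHom t ht F₀) = c := by
  obtain ⟨U₀, hU₀⟩ := TelescopeBranchTwistExpSeries.exists_eq_C_evalHom_add_X_sub_C_mul F₀ ht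
  have hmap : PowerSeries.map j F₀ = C (j (evalHom t ht F₀)) + (X - C (j t)) * PowerSeries.map j U₀ := by
    conv_lhs => rw [hU₀]
    rw [map_add, map_mul, map_sub, map_C, map_X, map_C]
  have ha : ‖((j t : unrIntegers p) : ℂ_[p])‖ < 1 := by rw [norm_coe_j j hj]; exact ht
  exact remainder_const_unique ha (hmap.symm.trans h)

/-- **Descent with values, packaged for G5.** Under the hypotheses of `exists_map_eq_of_remainders` (with `‖x_t‖ < 1`), there is
`F₀ ∈ ℤ_p⟦X⟧` with `PowerSeries.map j F₀ = F` and, for every `t`, `j (evalHom (x t) F₀)` = the remainder constant of `F` at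
`j x_t` (any one: they agree). [folklore] -/
theorem exists_map_eq_and_evalHom (j : ℤ_[p] →+* unrIntegers p)
    (hj : ∀ z : ℤ_[p], ((j z : unrIntegers p) : ℂ_[p]) = algebraMap ℚ_[p] ℂ_[p] (z : ℚ_[p]))
    (x : ℕ → ℤ_[p]) (hx : ∀ t, ‖x t‖ < 1) (hx0 : Tendsto x atTop (𝓝 0)) (hxne : ∀ t, x t ≠ 0)
    (F : UnrSeries p) (hF : ∀ t, ∃ c U, c ∈ Set.range j ∧ F = C c + (X - C (j (x t))) * U) :
    ∃ F₀ : ℤ_[p]⟦X⟧, PowerSeries.map j F₀ = F ∧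
      ∀ (t : ℕ) (c : unrIntegers p) (U : UnrSeries p), F = C c + (X - C (j (x t))) * U →
        j (evalHom (x t) (hx t) F₀) = c := by
  obtain ⟨F₀, hF₀⟩ := exists_map_eq_of_remainders j hj x hx0 hxne F hF
  exact ⟨F₀, hF₀.symm, fun t c U h => coe_j_evalHom_eq_of_remainder j hj F₀ (hx t) (hF₀ ▸ h)⟩

end Summit.BirchSwinnertonDyer.BirchSwinnertonDyer.Theorems.TelescopeBranchCoefficientDescent
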